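import Summits.NavierStokesRegularity.NavierStokesRegularity.Theorems.LerayQuarterDissipationRecurrentReductionDStage1Core
import Literature.Analysis.UnboundedOperators.HeatKernelBoundedData
import Mathlib.Topology.UniformSpace.HeineCantor
import HarnessLib

/-!
# Route `LerayQuarterDissipation`, item `RecurrentReductionD` (stmt-NavierStokesRegularity-22507):
# sup-norm ε-regularity for `𝒟`, Stage 1 — Type-I smallness on a parabolic region

Helper file (theorems only, `--supports` the item). For a Type-I ancient mild field `v`
(constant `C`) which is small on one slice, `‖v(t₁, y)‖ ≤ ε₀` for `‖y‖ ≤ A`, this file proves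
(`stage1_typeI_small`) that on the parabolic region
`Ω₀ = {(τ,y) : t₁ < τ < 0, ‖y‖ < R + M√(−τ)}`, `R + M√(−t₁) < A`, one has
`‖v(τ, y)‖ ≤ a + η(−τ)^{−1/2}` — provided the numerical constraints linking `(a, η, M, θ, R, A,
ε₀, t₁)` to `C` and the kernel constants hold (they are satisfiable by taking `η, θ` small, `M`
large, then `A` large and `−t₁` small; this choice is made in the final assembly).
Proof: the first bad time `t⋆ = inf {bad τ}` is `> t₁` (continuity at the initial slice); at a
bad point `(τ_b, y_b)` just after `t⋆` the mild identity, the heat bound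
(`norm_heatExtension_le_of_small_on_ball`: `|e^{σΔ}f(x)| ≤ ε₀ + ‖f‖_∞ c_G √σ/(A − A₁)` for
`‖x‖ ≤ A₁`) and the core Duhamel estimate `duhamel_le_of_goodBefore` (good region before `t⋆`,
a short crude layer, Type-I exterior) give `‖v(τ_b,y_b)‖ ≤ 3a/4 + (η/2)(−τ_b)^{−1/2}`,
contradicting badness.

References: G. Koch, N. Nadirashvili, G. Seregin, V. Šverák, arXiv:0709.3599, §4
[KochNadirashviliSereginSverak2009].
-/

noncomputable section

-- the summit and its single problem share the name (D-0017 nested layout)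
set_option linter.dupNamespace false

namespace Summit.NavierStokesRegularity.NavierStokesRegularity.Theorems.RecurrentReductionD

open MeasureTheory Set Function Filter Topology Metric
open Literature.Analysis Literature.Analysis.FluidPDE Literature.Analysis.UnboundedOperators
open scoped ENNReal NNReal

/-! ### The heat term of a slice which is small on a big ball -/

/-- **Heat flow of data small on a big ball**: if `f` is continuous, `‖f‖ ≤ M_f` everywhere and
`‖f(y)‖ ≤ ε` for `‖y‖ ≤ A`, then for `‖x‖ ≤ A₁ < A` and `σ > 0`,
`‖e^{σΔ}f(x)‖ ≤ ε + M_f · (2·2^{3/2}√σ)/(A − A₁)`: outside `B(0, A)` one has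
`‖y − x‖ > A − A₁`, so `‖f(x−y)‖ ≤ ε + M_f ‖y‖/(A − A₁)` for all `y`, and
`∫ G_σ(y)‖y‖ dy ≤ 2·2^{3/2}√σ` (`integral_heatKernel_mul_norm_le`). [folklore] -/
theorem norm_heatExtension_le_of_small_on_ball {f : EuclideanSpace ℝ (Fin 3) → EuclideanSpace ℝ (Fin 3)}
    {Mf ε A A₁ σ : ℝ} (hMf : 0 ≤ Mf) (hε : 0 ≤ ε) (hA : A₁ < A) (hσ : 0 < σ)
    (hfb : ∀ y, ‖f y‖ ≤ Mf) (hsmall : ∀ y, ‖y‖ ≤ A → ‖f y‖ ≤ ε)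
    {x : EuclideanSpace ℝ (Fin 3)} (hx : ‖x‖ ≤ A₁) :
    ‖heatExtension f σ x‖ ≤ ε + Mf * (2 * (2 : ℝ) ^ ((3 : ℝ) / 2) * σ ^ (1 / 2 : ℝ)) / (A - A₁) := by
  have hAA : 0 < A - A₁ := sub_pos.2 hA
  rw [heatExtension_apply]
  -- pointwise bound of the integrand
  have hpt : ∀ y, ‖heatKernel σ y • f (x - y)‖ ≤ heatKernel σ y * ε + Mf / (A - A₁) * (heatKernel σ y * ‖y‖) := by
    intro y
    have hG := (heatKernel_pos hσ y).le
    rw [norm_smul, Real.norm_of_nonneg hG]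
    have hf : ‖f (x - y)‖ ≤ ε + Mf / (A - A₁) * ‖y‖ := by
      by_cases hy : ‖x - y‖ ≤ A
      · have h1 := hsmall (x - y) hy
        have h2 : 0 ≤ Mf / (A - A₁) * ‖y‖ := by positivity
        linarith
      · have hy' : A < ‖x - y‖ := not_le.1 hy
        have hxy : ‖x - y‖ ≤ ‖x‖ + ‖y‖ := norm_sub_le x y
        have h3 : A - A₁ ≤ ‖y‖ := by linarith
        have h4 : Mf ≤ Mf / (A - A₁) * ‖y‖ := by
          rw [div_mul_eq_mul_div, le_div_iff₀ hAA]
          exact mul_le_mul_of_nonneg_left h3 hMf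
        linarith [hfb (x - y)]
    calc heatKernel σ y * ‖f (x - y)‖ ≤ heatKernel σ y * (ε + Mf / (A - A₁) * ‖y‖) :=
          mul_le_mul_of_nonneg_left hf hG
      _ = heatKernel σ y * ε + Mf / (A - A₁) * (heatKernel σ y * ‖y‖) := by ring
  have hint : Integrable (fun y : EuclideanSpace ℝ (Fin 3) =>
      heatKernel σ y * ε + Mf / (A - A₁) * (heatKernel σ y * ‖y‖)) :=
    ((integrable_heatKernel_holds hσ).mul_const ε).add
      ((integrable_heatKernel_mul_norm hσ).const_mul _)
  refine (norm_integral_le_of_norm_le hint (Eventually.of_forall hpt)).trans ?_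
  rw [integral_add ((integrable_heatKernel_holds hσ).mul_const ε)
    ((integrable_heatKernel_mul_norm hσ).const_mul _), integral_mul_const, integral_const_mul,
    integral_heatKernel_eq_one_holds hσ, one_mul]
  have hmom := integral_heatKernel_mul_norm_le (E := EuclideanSpace ℝ (Fin 3)) hσ
  rw [finrank_euclideanSpace_fin] at hmom
  norm_num at hmom
  have : Mf / (A - A₁) * ∫ y : EuclideanSpace ℝ (Fin 3), heatKernel σ y * ‖y‖ ≤
      Mf / (A - A₁) * (2 * (2 : ℝ) ^ ((3 : ℝ) / 2) * σ ^ (1 / 2 : ℝ)) :=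
    mul_le_mul_of_nonneg_left hmom (by positivity)
  calc ε + Mf / (A - A₁) * ∫ y : EuclideanSpace ℝ (Fin 3), heatKernel σ y * ‖y‖
      ≤ ε + Mf / (A - A₁) * (2 * (2 : ℝ) ^ ((3 : ℝ) / 2) * σ ^ (1 / 2 : ℝ)) := by linarith
    _ = ε + Mf * (2 * (2 : ℝ) ^ ((3 : ℝ) / 2) * σ ^ (1 / 2 : ℝ)) / (A - A₁) := by ring

/-! ### Stage 1: Type-I smallness on the parabolic region -/

/-- **Stage 1 of the ε-regularity bootstrap.** Let `v` be a Type-I ancient mild field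
(constant `C`), small on the slice `t₁ < 0`: `‖v(t₁,y)‖ ≤ ε₀` for `‖y‖ ≤ A`. Under the stated
numerical constraints on the parameters `a, η > 0`, `M, θ > 0`, `R`, `A > R + M√(−t₁)`
(`κ₁ = C₀∫(1+‖w‖²)^{−2}`, `κ₂ = 3C₀|B₁|`, `C₀` the kernel constant), `v` obeys
`‖v(τ,y)‖ ≤ a + η(−τ)^{−1/2}` for all `t₁ < τ < 0`, `‖y‖ < R + M√(−τ)` (module docstring:
first-bad-time argument on the mild identity). [cite: KochNadirashviliSereginSverak2009, §4 p. 8 (arXiv:0709.3599)] -/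
theorem stage1_typeI_small {C₀ : ℝ} (hC₀ : 0 < C₀)
    (hK : ∀ ⦃σ : ℝ⦄, 0 < σ → ∀ z a b : EuclideanSpace ℝ (Fin 3),
      ‖oseenKernel σ z a b‖ ≤ C₀ * (σ + ‖z‖ ^ 2) ^ (-(2 : ℝ)) * ‖a‖ * ‖b‖)
    {C : ℝ} {v : ℝ → EuclideanSpace ℝ (Fin 3) → EuclideanSpace ℝ (Fin 3)}
    (hv : IsTypeIAncientMild C v)
    {t₁ A R M a η θ ε₀ : ℝ} (ht₁ : t₁ < 0) (hM : 0 < M) (ha : 0 < a) (hη : 0 < η)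
    (hθ : 0 < θ) (hε₀ : 0 ≤ ε₀) (hA : R + M * Real.sqrt (-t₁) < A)
    (hdata : ∀ y : EuclideanSpace ℝ (Fin 3), ‖y‖ ≤ A → ‖v t₁ y‖ ≤ ε₀)
    (c_heat : ε₀ + C / Real.sqrt (-t₁) * (2 * (2 : ℝ) ^ ((3 : ℝ) / 2) * (-t₁) ^ (1 / 2 : ℝ)) /
      (A - (R + M * Real.sqrt (-t₁))) ≤ a / 4)
    (c_near : 16 * (C₀ * ∫ w : EuclideanSpace ℝ (Fin 3), (1 + ‖w‖ ^ 2) ^ (-(2 : ℝ))) * a *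
      Real.sqrt (-t₁) ≤ 1)
    (c_eta : 32 * (C₀ * ∫ w : EuclideanSpace ℝ (Fin 3), (1 + ‖w‖ ^ 2) ^ (-(2 : ℝ))) * η ≤ 1)
    (c_rec : 2 * (C₀ * ∫ w : EuclideanSpace ℝ (Fin 3), (1 + ‖w‖ ^ 2) ^ (-(2 : ℝ))) * C ^ 2 *
      Real.sqrt θ ≤ η / 8)
    (c_old : 8 * (C₀ * (3 * (volume : Measure (EuclideanSpace ℝ (Fin 3))).real (ball 0 1))) *
      C ^ 2 * θ ^ (-(1 / 4 : ℝ)) / M ≤ η / 8) :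
    ∀ τ ∈ Ioo t₁ 0, ∀ y : EuclideanSpace ℝ (Fin 3),
      ‖y‖ < R + M * Real.sqrt (-τ) → ‖v τ y‖ ≤ a + η * (-τ) ^ (-(1 / 2 : ℝ)) := by
  have hI₂pos : 0 < ∫ w : EuclideanSpace ℝ (Fin 3), (1 + ‖w‖ ^ 2) ^ (-(2 : ℝ)) :=
    integral_one_add_norm_sq_rpow_neg_pos (E := EuclideanSpace ℝ (Fin 3))
      (by rw [finrank_euclideanSpace_fin]; norm_num)
  obtain ⟨κ₁, hκ₁⟩ : ∃ κ₁ : ℝ, κ₁ = C₀ * ∫ w : EuclideanSpace ℝ (Fin 3), (1 + ‖w‖ ^ 2) ^ (-(2 : ℝ)) :=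
    ⟨_, rfl⟩
  rw [← hκ₁] at c_near c_eta c_rec
  have hκ₁pos : 0 < κ₁ := by rw [hκ₁]; exact mul_pos hC₀ hI₂pos
  obtain ⟨A₁, hA₁⟩ : ∃ A₁ : ℝ, A₁ = R + M * Real.sqrt (-t₁) := ⟨_, rfl⟩
  rw [← hA₁] at hA c_heat
  have hC : 0 ≤ C := hv.nonneg
  have hnt₁ : 0 < -t₁ := neg_pos.2 ht₁
  have hA₁A : A₁ < A := hA
  have hAA : 0 < A - A₁ := sub_pos.2 hA
  -- the radius is decreasing in time
  have hr_mono : ∀ {τ}, t₁ ≤ τ → τ ≤ 0 → R + M * Real.sqrt (-τ) ≤ A₁ := fun {τ} h1 _ =>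
    by rw [hA₁]; gcongr
  -- ## the bad set
  set Bad : Set ℝ := {τ | τ ∈ Ioo t₁ 0 ∧ ∃ y : EuclideanSpace ℝ (Fin 3),
    ‖y‖ < R + M * Real.sqrt (-τ) ∧ a + η * (-τ) ^ (-(1 / 2 : ℝ)) < ‖v τ y‖} with hBad
  by_contra hcon
  push Not at hcon
  obtain ⟨τ₀, hτ₀, y₀, hy₀, hbad₀⟩ := hcon
  have hne : Bad.Nonempty := ⟨τ₀, hτ₀, y₀, hy₀, hbad₀⟩
  have hbdd : BddBelow Bad := ⟨t₁, fun τ hτ => hτ.1.1.le⟩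
  -- ## initial layer: no bad times near `t₁` (uniform continuity on a compact piece)
  obtain ⟨δ₀, hδ₀, hinit⟩ : ∃ δ₀ > 0, ∀ τ ∈ Bad, t₁ + δ₀ ≤ τ := by
    have hKc : IsCompact (Icc t₁ (t₁ / 2) ×ˢ closedBall (0 : EuclideanSpace ℝ (Fin 3)) A₁) :=
      isCompact_Icc.prod (isCompact_closedBall _ _)
    have hKsub : Icc t₁ (t₁ / 2) ×ˢ closedBall (0 : EuclideanSpace ℝ (Fin 3)) A₁ ⊆ Iio 0 ×ˢ univ :=
      prod_mono (fun τ hτ => lt_of_le_of_lt hτ.2 (by linarith)) (subset_univ _)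
    have huc := hKc.uniformContinuousOn_of_continuous (hv.continuousOn_uncurry.mono hKsub)
    rw [Metric.uniformContinuousOn_iff] at huc
    obtain ⟨δ, hδ, hδuc⟩ := huc (a / 2) (by positivity)
    refine ⟨min δ (-t₁ / 2) / 2, by positivity, fun τ hτ => ?_⟩
    by_contra hlt
    push Not at hlt
    obtain ⟨⟨hτ1, hτ0⟩, y, hy, hbad⟩ := hτ
    have hτδ : τ - t₁ < δ := by
      have : min δ (-t₁ / 2) / 2 < δ := by
        have := min_le_left δ (-t₁ / 2); linarith
      linarith
    have hτhalf : τ ≤ t₁ / 2 := by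
      have : min δ (-t₁ / 2) / 2 ≤ -t₁ / 2 / 2 := by
        have := min_le_right δ (-t₁ / 2); linarith
      linarith
    have hyA₁ : ‖y‖ ≤ A₁ := (hy.trans_le (hr_mono hτ1.le hτ0.le)).le
    have hp : ((τ, y) : ℝ × EuclideanSpace ℝ (Fin 3)) ∈
        Icc t₁ (t₁ / 2) ×ˢ closedBall (0 : EuclideanSpace ℝ (Fin 3)) A₁ :=
      ⟨⟨hτ1.le, hτhalf⟩, mem_closedBall_zero_iff.2 hyA₁⟩
    have hq : ((t₁, y) : ℝ × EuclideanSpace ℝ (Fin 3)) ∈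
        Icc t₁ (t₁ / 2) ×ˢ closedBall (0 : EuclideanSpace ℝ (Fin 3)) A₁ :=
      ⟨⟨le_rfl, by linarith⟩, mem_closedBall_zero_iff.2 hyA₁⟩
    have hdist : dist ((τ, y) : ℝ × EuclideanSpace ℝ (Fin 3)) (t₁, y) < δ := by
      rw [Prod.dist_eq, dist_self, Real.dist_eq, abs_of_pos (by linarith)]
      exact max_lt hτδ (by linarith [hδ])
    have hclose := hδuc _ hp _ hq hdist
    rw [dist_eq_norm] at hclose
    have h0 : ‖v t₁ y‖ ≤ ε₀ := hdata y (hyA₁.trans hA₁A.le)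
    have hε₀a : ε₀ ≤ a / 4 := by
      have h2 : 0 ≤ C / Real.sqrt (-t₁) * (2 * (2 : ℝ) ^ ((3 : ℝ) / 2) * (-t₁) ^ (1 / 2 : ℝ)) /
          (A - A₁) :=
        div_nonneg (mul_nonneg (div_nonneg hC (Real.sqrt_nonneg _)) (by positivity)) hAA.le
      linarith
    have hηp : 0 ≤ η * (-τ) ^ (-(1 / 2 : ℝ)) := mul_nonneg hη.le (Real.rpow_nonneg (by linarith) _)
    have : ‖v τ y‖ ≤ ‖v τ y - v t₁ y‖ + ‖v t₁ y‖ := norm_le_norm_sub_add _ _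
    have : ‖uncurry v (τ, y) - uncurry v (t₁, y)‖ = ‖v τ y - v t₁ y‖ := rfl
    linarith
  -- ## the first bad time
  set tstar : ℝ := sInf Bad with htstar
  have hts_le : ∀ τ ∈ Bad, tstar ≤ τ := fun τ hτ => csInf_le hbdd hτ
  have hts_ge : t₁ + δ₀ ≤ tstar := le_csInf hne hinit
  have hts1 : t₁ < tstar := by linarith
  have hts0 : tstar < 0 := (hts_le τ₀ ⟨hτ₀, y₀, hy₀, hbad₀⟩).trans_lt hτ₀.2
  have hgood : ∀ τ ∈ Ioo t₁ tstar, ∀ y : EuclideanSpace ℝ (Fin 3),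
      ‖y‖ < R + M * Real.sqrt (-τ) → ‖v τ y‖ ≤ a + η * (-τ) ^ (-(1 / 2 : ℝ)) := by
    intro τ hτ y hy
    by_contra hlt
    push Not at hlt
    have hmem : τ ∈ Bad := ⟨⟨hτ.1, hτ.2.trans hts0⟩, y, hy, hlt⟩
    exact not_lt.2 (hts_le τ hmem) hτ.2
  -- ## a bad point just after `tstar`
  set δ₁ : ℝ := (a * (-tstar) / (16 * κ₁ * C ^ 2 + 1)) ^ 2 with hδ₁
  have hnts : 0 < -tstar := neg_pos.2 hts0
  have hden : 0 < 16 * κ₁ * C ^ 2 + 1 := by nlinarith [hκ₁pos, sq_nonneg C]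
  have hδ₁pos : 0 < δ₁ := by rw [hδ₁]; positivity
  set δ : ℝ := min (-tstar / 2) δ₁ with hδ
  have hδpos : 0 < δ := lt_min (by linarith) hδ₁pos
  obtain ⟨τb, hτbBad, hτblt⟩ := exists_lt_of_csInf_lt hne (by linarith : sInf Bad < tstar + δ)
  have hτbge : tstar ≤ τb := hts_le τb hτbBad
  obtain ⟨⟨hτb1, hτb0⟩, yb, hyb, hbadb⟩ := hτbBad
  have hnτb : 0 < -τb := neg_pos.2 hτb0
  have hτbhalf : -tstar / 2 ≤ -τb := by
    have : δ ≤ -tstar / 2 := min_le_left _ _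
    linarith
  -- ## the core Duhamel estimate at the bad point
  have hB := duhamel_le_of_goodBefore hC₀ hK hv hts1 hτbge hτb0 hM hη.le hθ hgood hyb
  rw [← hκ₁] at hB
  -- ## the heat term at the bad point
  have hmild : v τb yb = heatExtension (v t₁) (τb - t₁) yb - oseenDuhamel 1 t₁ v v τb yb :=
    hv.mild_eq_heatExtension hτb1 hτb0 yb
  have hheat : ‖heatExtension (v t₁) (τb - t₁) yb‖ ≤ a / 4 := by
    have hybA₁ : ‖yb‖ ≤ A₁ := (hyb.trans_le (hr_mono hτb1.le hτb0.le)).le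
    have h := norm_heatExtension_le_of_small_on_ball (f := v t₁)
      (Mf := C / Real.sqrt (-t₁)) (div_nonneg hC (Real.sqrt_nonneg _)) hε₀ hA₁A (sub_pos.2 hτb1)
      (fun y => hv.norm_le ht₁ y) hdata hybA₁
    refine h.trans (le_trans ?_ c_heat)
    have hσle : (τb - t₁) ^ (1 / 2 : ℝ) ≤ (-t₁) ^ (1 / 2 : ℝ) :=
      Real.rpow_le_rpow (by linarith) (by linarith) (by norm_num)
    have hMf : 0 ≤ C / Real.sqrt (-t₁) := div_nonneg hC (Real.sqrt_nonneg _)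
    gcongr
  -- ## the numerical bookkeeping
  have hnear : 4 * κ₁ * a ^ 2 * Real.sqrt (τb - t₁) ≤ a / 4 := by
    have h1 : Real.sqrt (τb - t₁) ≤ Real.sqrt (-t₁) := Real.sqrt_le_sqrt (by linarith)
    calc 4 * κ₁ * a ^ 2 * Real.sqrt (τb - t₁) ≤ 4 * κ₁ * a ^ 2 * Real.sqrt (-t₁) := by gcongr
      _ = a / 4 * (16 * κ₁ * a * Real.sqrt (-t₁)) := by ring
      _ ≤ a / 4 * 1 := mul_le_mul_of_nonneg_left c_near (by positivity)
      _ = a / 4 := mul_one _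
  have hcrude : 2 * κ₁ * (C ^ 2 / (-τb)) * Real.sqrt (τb - tstar) ≤ a / 4 := by
    have hXpos : 0 ≤ a * (-tstar) / (16 * κ₁ * C ^ 2 + 1) := by positivity
    have h1 : Real.sqrt (τb - tstar) ≤ a * (-tstar) / (16 * κ₁ * C ^ 2 + 1) := by
      rw [← Real.sqrt_sq hXpos, ← hδ₁]
      exact Real.sqrt_le_sqrt (by have : δ ≤ δ₁ := min_le_right _ _; linarith)
    have h3 : C ^ 2 / (-τb) ≤ 2 * C ^ 2 / (-tstar) := by
      rw [div_le_div_iff₀ hnτb hnts]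
      have := mul_nonneg (sq_nonneg C) (show (0 : ℝ) ≤ 2 * -τb - -tstar by linarith)
      linarith [this]
    have e : 2 * C ^ 2 / (-tstar) * (a * (-tstar) / (16 * κ₁ * C ^ 2 + 1)) =
        2 * C ^ 2 * a / (16 * κ₁ * C ^ 2 + 1) := by
      rw [div_mul_div_comm, show 2 * C ^ 2 * (a * -tstar) = -tstar * (2 * C ^ 2 * a) by ring,
        mul_div_mul_left _ _ hnts.ne']
    calc 2 * κ₁ * (C ^ 2 / (-τb)) * Real.sqrt (τb - tstar)
        ≤ 2 * κ₁ * (2 * C ^ 2 / (-tstar)) * (a * (-tstar) / (16 * κ₁ * C ^ 2 + 1)) := by gcongr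
      _ = 2 * κ₁ * (2 * C ^ 2 * a / (16 * κ₁ * C ^ 2 + 1)) := by rw [mul_assoc (2 * κ₁), e]
      _ ≤ a / 4 := by
          rw [← mul_div_assoc, div_le_div_iff₀ hden (by norm_num : (0 : ℝ) < 4)]
          have : 0 ≤ κ₁ * C ^ 2 * a := by positivity
          linarith [ha.le]
  have hηterm : 8 * κ₁ * η ^ 2 + 2 * κ₁ * C ^ 2 * Real.sqrt θ +
      8 * (C₀ * (3 * (volume : Measure (EuclideanSpace ℝ (Fin 3))).real (ball 0 1))) * C ^ 2 *
        θ ^ (-(1 / 4 : ℝ)) / M ≤ η / 2 := by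
    have h1 : 8 * κ₁ * η ^ 2 ≤ η / 4 := by
      calc 8 * κ₁ * η ^ 2 = η / 4 * (32 * κ₁ * η) := by ring
        _ ≤ η / 4 * 1 := mul_le_mul_of_nonneg_left c_eta (by positivity)
        _ = η / 4 := mul_one _
    linarith
  -- ## contradiction
  have hpow : 0 < (-τb) ^ (-(1 / 2 : ℝ)) := Real.rpow_pos_of_pos hnτb _
  have htot : ‖v τb yb‖ ≤ 3 * a / 4 + η / 2 * (-τb) ^ (-(1 / 2 : ℝ)) := by
    rw [hmild]
    refine (norm_sub_le _ _).trans ?_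
    have hB' : ‖oseenDuhamel 1 t₁ v v τb yb‖ ≤ a / 4 + a / 4 + η / 2 * (-τb) ^ (-(1 / 2 : ℝ)) := by
      refine hB.trans ?_
      have := mul_le_mul_of_nonneg_right hηterm hpow.le
      linarith
    linarith
  have : a + η * (-τb) ^ (-(1 / 2 : ℝ)) < ‖v τb yb‖ := hbadb
  have := mul_pos hη hpow
  linarith

end Summit.NavierStokesRegularity.NavierStokesRegularity.Theorems.RecurrentReductionD

end
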